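/-
Copyright (c) 2026. All rights reserved.
Released under Apache 2.0 license as described in the file LICENSE.
-/
import Summits.AtomisticToContinuum.Crystallization.Theorems.OverbindingBudgetAffineFarSlotRecord

/-!
# Overbinding budget — R_aff′ brick R00 (linear algebra): operator bound from a two-shell frame and near-conformality transfer

Slot Z of `stmt-AtomisticToContinuum-31280`, leaf `…FarSmoothSplit.AffineChartStraightening'` (R_aff′), radial development (g59 memo §3,
brick R00 `AdjacentComparability`, linear-algebra half).  Three facts used by every snapping step and by the assembly:

* §1 `axis_mem_twoShell` — both two-shell patterns contain the three axis vectors `√2·eₐ` (second shell: `(±2,0,0)/√2` in fcc,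
  `(6,0,0)/√18` in hcp).
* §2 `norm_le_of_twoShell` — a linear map bounded by `θ` on the pattern is bounded by `(√6/2)·θ·‖v‖` everywhere (write
  `v = Σ (vₐ/√2)·(√2 eₐ)` and use `Σ|vₐ| ≤ √3‖v‖`, both inlined); corollary `norm_sub_le_of_affFrame` for the AffFramed pair `(A, Q)`:
  `‖A v − Q v‖ ≤ (√6/2)θ‖v‖` — this is clause (b) of R_aff′ (`(√6/2)θ ≤ 2θ`) and the input `τ = (√6/2)θ` of §3.
* §3 `nearConformal_transfer` — if `‖A_j − Q_j‖, ‖A_k − Q_k‖ ≤ τ` (operator sense), and the pattern-side relabelling `M` satisfies the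
  PHYSICAL-side estimate `‖a·A_j(M v) − b·A_k v‖ ≤ η‖v‖` (`a = nn_j`, `b = nn_k`; this is what FRAME's `halfFrame_opNorm_le` delivers, no inverse
  of `A_j` needed), then `M` is `1/5`-near-conformal: `‖M v − s·Q v‖ ≤ (1/5)s‖v‖` with `s = b/a`, `Q = Q_j⁻¹Q_k`, provided
  `5(η + 2bτ) ≤ b(1 − τ)` (at `θ = 1/25`: `τ = 0.049`, so `η ≤ 0.09·b` suffices — η is `O(ε₁·nn)`).  This is exactly the hypothesis `hconf` of
  SNAP's `snapRigidity_pair`.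
-/

namespace Summit.AtomisticToContinuum.Crystallization.Theorems.OverbindingBudgetAffineFarSmoothSplit

open scoped BigOperators RealInnerProductSpace
open Literature.Geometry.DiscreteGeometry (fccTwoShellPattern hcpTwoShellPattern scaledPattern intVec intVec_apply sqNormInt fccInt hcpInt
  fccSecondShellInt hcpSecondShellInt)

/-! ## §1  Axis vectors of the two-shell patterns -/

/-- The axis vector `√2·eₐ` as a scaled integer vector at scale `√2`: `(√2)⁻¹ • (2eₐ)`. [this file] -/
theorem axis_eq_scaled_two (a : Fin 3) :
    Real.sqrt 2 • EuclideanSpace.single a (1 : ℝ) = (Real.sqrt 2)⁻¹ • intVec (Pi.single a (2 : ℤ) : Fin 3 → ℤ) := by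
  have h2pos : 0 < Real.sqrt 2 := by positivity
  have h2 : Real.sqrt 2 * Real.sqrt 2 = 2 := Real.mul_self_sqrt (by norm_num)
  have hs : (Real.sqrt 2)⁻¹ * 2 = Real.sqrt 2 :=
    calc (Real.sqrt 2)⁻¹ * 2 = (Real.sqrt 2)⁻¹ * (Real.sqrt 2 * Real.sqrt 2) := by rw [h2]
      _ = Real.sqrt 2 := inv_mul_cancel_left₀ h2pos.ne' _
  ext j
  by_cases hj : j = a
  · subst hj; simp [intVec_apply, hs]
  · simp [intVec_apply, hj]

/-- The axis vector `√2·eₐ` as a scaled integer vector at scale `√18`: `(√18)⁻¹ • (6eₐ)`. [this file] -/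
theorem axis_eq_scaled_eighteen (a : Fin 3) :
    Real.sqrt 2 • EuclideanSpace.single a (1 : ℝ) = (Real.sqrt 18)⁻¹ • intVec (Pi.single a (6 : ℤ) : Fin 3 → ℤ) := by
  have h2pos : 0 < Real.sqrt 2 := by positivity
  have h2 : Real.sqrt 2 * Real.sqrt 2 = 2 := Real.mul_self_sqrt (by norm_num)
  have h18 : Real.sqrt 18 = 3 * Real.sqrt 2 := by
    rw [show (18 : ℝ) = 3 ^ 2 * 2 by norm_num, Real.sqrt_mul (by norm_num), Real.sqrt_sq (by norm_num)]
  have hs : (Real.sqrt 18)⁻¹ * 6 = Real.sqrt 2 :=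
    calc (Real.sqrt 18)⁻¹ * 6 = (3 * Real.sqrt 2)⁻¹ * ((3 * Real.sqrt 2) * Real.sqrt 2) := by
          rw [h18, mul_assoc, h2]; norm_num
      _ = Real.sqrt 2 := inv_mul_cancel_left₀ (by positivity) _
  ext j
  by_cases hj : j = a
  · subst hj; simp [intVec_apply, hs]
  · simp [intVec_apply, hj]

/-- `2eₐ ∈ fccSecondShellInt`. [this file] -/
theorem single_two_mem_fccSecondShellInt : ∀ a : Fin 3, (Pi.single a (2 : ℤ) : Fin 3 → ℤ) ∈ fccInt ∪ fccSecondShellInt := by decide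

/-- `6eₐ ∈ hcpSecondShellInt`. [this file] -/
theorem single_six_mem_hcpSecondShellInt : ∀ a : Fin 3, (Pi.single a (6 : ℤ) : Fin 3 → ℤ) ∈ hcpInt ∪ hcpSecondShellInt := by decide

/-- **Axis vectors.**  Both two-shell patterns contain `√2·eₐ`, `a = 0, 1, 2`. [this file] -/
theorem axis_mem_twoShell {P : Finset (EuclideanSpace ℝ (Fin 3))} (hP : P = fccTwoShellPattern ∨ P = hcpTwoShellPattern) (a : Fin 3) :
    Real.sqrt 2 • EuclideanSpace.single a (1 : ℝ) ∈ P := by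
  rcases hP with rfl | rfl
  · rw [axis_eq_scaled_two]
    exact Finset.mem_image_of_mem _ (single_two_mem_fccSecondShellInt a)
  · rw [axis_eq_scaled_eighteen]
    exact Finset.mem_image_of_mem _ (single_six_mem_hcpSecondShellInt a)

/-! ## §2  Operator bound from the pattern bound -/

/-- **Operator bound from the pattern bound.**  A linear map bounded by `θ` on a two-shell pattern satisfies
`‖L v‖ ≤ (√6/2)·θ·‖v‖`. [this file] -/
theorem norm_le_of_twoShell {P : Finset (EuclideanSpace ℝ (Fin 3))} (hP : P = fccTwoShellPattern ∨ P = hcpTwoShellPattern)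
    (L : EuclideanSpace ℝ (Fin 3) →ₗ[ℝ] EuclideanSpace ℝ (Fin 3)) {θ : ℝ} (hθ : ∀ v ∈ P, ‖L v‖ ≤ θ) (v : EuclideanSpace ℝ (Fin 3)) :
    ‖L v‖ ≤ Real.sqrt 6 / 2 * θ * ‖v‖ := by
  have h2pos : 0 < Real.sqrt 2 := by positivity
  have h2 : Real.sqrt 2 * Real.sqrt 2 = 2 := Real.mul_self_sqrt (by norm_num)
  have h6 : Real.sqrt 6 = Real.sqrt 2 * Real.sqrt 3 := by
    rw [show (6 : ℝ) = 2 * 3 by norm_num, Real.sqrt_mul (by norm_num)]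
  have hθ0 : 0 ≤ θ := le_trans (norm_nonneg _) (hθ _ (axis_mem_twoShell hP 0))
  -- `L eₐ = (√2)⁻¹ • L (√2 eₐ)`, so `‖L eₐ‖ ≤ θ/√2`
  have hax : ∀ a : Fin 3, ‖L (EuclideanSpace.single a (1 : ℝ))‖ ≤ (Real.sqrt 2)⁻¹ * θ := by
    intro a
    have hx : EuclideanSpace.single a (1 : ℝ) = (Real.sqrt 2)⁻¹ • (Real.sqrt 2 • EuclideanSpace.single a (1 : ℝ)) := by
      rw [smul_smul, inv_mul_cancel₀ h2pos.ne', one_smul]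
    rw [hx, map_smul, norm_smul, Real.norm_of_nonneg (by positivity)]
    exact mul_le_mul_of_nonneg_left (hθ _ (axis_mem_twoShell hP a)) (by positivity)
  have hv : v = v 0 • EuclideanSpace.single 0 (1 : ℝ) + v 1 • EuclideanSpace.single 1 (1 : ℝ) + v 2 • EuclideanSpace.single 2 (1 : ℝ) := by
    ext j
    fin_cases j <;> simp
  have hLv : L v = v 0 • L (EuclideanSpace.single 0 (1 : ℝ)) + v 1 • L (EuclideanSpace.single 1 (1 : ℝ)) +
      v 2 • L (EuclideanSpace.single 2 (1 : ℝ)) := by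
    conv_lhs => rw [hv]
    simp only [map_add, map_smul]
  -- `|v₀| + |v₁| + |v₂| ≤ √3‖v‖` (Cauchy–Schwarz)
  have hsum : |v 0| + |v 1| + |v 2| ≤ Real.sqrt 3 * ‖v‖ := by
    have hn : ‖v‖ ^ 2 = v 0 ^ 2 + v 1 ^ 2 + v 2 ^ 2 := by
      rw [EuclideanSpace.real_norm_sq_eq, Fin.sum_univ_three]
    have h3 : Real.sqrt 3 ^ 2 = 3 := Real.sq_sqrt (by norm_num)
    have hsq : (|v 0| + |v 1| + |v 2|) ^ 2 ≤ (Real.sqrt 3 * ‖v‖) ^ 2 := by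
      rw [mul_pow, h3, hn]
      nlinarith [sq_abs (v 0), sq_abs (v 1), sq_abs (v 2), sq_nonneg (|v 0| - |v 1|), sq_nonneg (|v 1| - |v 2|),
        sq_nonneg (|v 0| - |v 2|)]
    exact (pow_le_pow_iff_left₀ (by positivity) (by positivity) two_ne_zero).1 hsq
  have hc : Real.sqrt 3 * (Real.sqrt 2)⁻¹ = Real.sqrt 6 / 2 := by
    rw [h6, eq_div_iff (by norm_num : (2 : ℝ) ≠ 0)]
    calc Real.sqrt 3 * (Real.sqrt 2)⁻¹ * 2 = Real.sqrt 3 * ((Real.sqrt 2)⁻¹ * (Real.sqrt 2 * Real.sqrt 2)) := by rw [h2]; ring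
      _ = Real.sqrt 3 * Real.sqrt 2 := by rw [inv_mul_cancel_left₀ h2pos.ne']
      _ = Real.sqrt 2 * Real.sqrt 3 := mul_comm _ _
  calc ‖L v‖ ≤ |v 0| * ((Real.sqrt 2)⁻¹ * θ) + |v 1| * ((Real.sqrt 2)⁻¹ * θ) + |v 2| * ((Real.sqrt 2)⁻¹ * θ) := by
        rw [hLv]
        refine le_trans (norm_add₃_le) ?_
        rw [norm_smul, norm_smul, norm_smul, Real.norm_eq_abs, Real.norm_eq_abs, Real.norm_eq_abs]
        gcongr
        · exact hax 0
        · exact hax 1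
        · exact hax 2
    _ = (|v 0| + |v 1| + |v 2|) * ((Real.sqrt 2)⁻¹ * θ) := by ring
    _ ≤ Real.sqrt 3 * ‖v‖ * ((Real.sqrt 2)⁻¹ * θ) := mul_le_mul_of_nonneg_right hsum (by positivity)
    _ = Real.sqrt 3 * (Real.sqrt 2)⁻¹ * θ * ‖v‖ := by ring
    _ = Real.sqrt 6 / 2 * θ * ‖v‖ := by rw [hc]

/-- **Clause (b) input.**  For an AffFramed pair `(A, Q)` on a two-shell pattern: `‖A v − Q v‖ ≤ (√6/2)θ‖v‖`. [this file] -/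
theorem norm_sub_le_of_affFrame {P : Finset (EuclideanSpace ℝ (Fin 3))} (hP : P = fccTwoShellPattern ∨ P = hcpTwoShellPattern)
    (A : EuclideanSpace ℝ (Fin 3) →ₗ[ℝ] EuclideanSpace ℝ (Fin 3)) (Q : EuclideanSpace ℝ (Fin 3) →ₗᵢ[ℝ] EuclideanSpace ℝ (Fin 3))
    {θ : ℝ} (hθ : ∀ v ∈ P, ‖A v - Q v‖ ≤ θ) (v : EuclideanSpace ℝ (Fin 3)) :
    ‖A v - Q v‖ ≤ Real.sqrt 6 / 2 * θ * ‖v‖ := by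
  have h := norm_le_of_twoShell hP (A - Q.toLinearMap) (fun w hw => by simpa using hθ w hw) v
  simpa using h

/-- `(√6/2)θ ≤ 2θ` for `θ ≥ 0` (so clause (b) of R_aff′ holds with `B := A_i`, `Q₀ := Q_i`). [this file] -/
theorem sqrt_six_div_two_mul_le {θ : ℝ} (hθ : 0 ≤ θ) : Real.sqrt 6 / 2 * θ ≤ 2 * θ := by
  have h6 : Real.sqrt 6 ≤ 4 := by
    rw [show (4 : ℝ) = Real.sqrt (4 ^ 2) by rw [Real.sqrt_sq (by norm_num)]]
    exact Real.sqrt_le_sqrt (by norm_num)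
  nlinarith

/-! ## §3  Near-conformality transfer (the `hconf` input of SNAP) -/

/-- **Near-conformality transfer.**  `A_j, A_k` are `τ`-close to isometries `Q_j, Q_k` in operator norm; the pattern-side map `M` satisfies the
physical-side estimate `‖a·A_j(M v) − b·A_k v‖ ≤ η‖v‖` with `a, b > 0`, `η ≥ 0`; if `5(η + 2bτ) ≤ b(1 − τ)` then `M` is `1/5`-near-conformal with scale
`s = b/a` and isometry `Q_j⁻¹ ∘ Q_k`. [this file] -/
theorem nearConformal_transfer {Aj Ak M : EuclideanSpace ℝ (Fin 3) →ₗ[ℝ] EuclideanSpace ℝ (Fin 3)}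
    {Qj Qk : EuclideanSpace ℝ (Fin 3) →ₗᵢ[ℝ] EuclideanSpace ℝ (Fin 3)} {a b τ η : ℝ} (ha : 0 < a) (hb : 0 < b) (hτ : 0 ≤ τ)
    (hη : 0 ≤ η) (hj : ∀ v, ‖Aj v - Qj v‖ ≤ τ * ‖v‖) (hk : ∀ v, ‖Ak v - Qk v‖ ≤ τ * ‖v‖)
    (hM : ∀ v, ‖a • Aj (M v) - b • Ak v‖ ≤ η * ‖v‖) (hbudget : 5 * (η + 2 * b * τ) ≤ b * (1 - τ)) :
    ∃ (Q : EuclideanSpace ℝ (Fin 3) →ₗᵢ[ℝ] EuclideanSpace ℝ (Fin 3)) (s : ℝ), 0 < s ∧ ∀ v, ‖M v - s • Q v‖ ≤ 1 / 5 * s * ‖v‖ := by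
  let Ej : EuclideanSpace ℝ (Fin 3) ≃ₗᵢ[ℝ] EuclideanSpace ℝ (Fin 3) := Qj.toLinearIsometryEquiv rfl
  refine ⟨Ej.symm.toLinearIsometry.comp Qk, b / a, div_pos hb ha, fun v => ?_⟩
  have hτ1 : τ < 1 := by nlinarith
  set w := M v - (b / a) • (Ej.symm.toLinearIsometry.comp Qk) v with hw
  -- `Qj w = Qj (M v) − (b/a) Qk v`
  have hQw : Qj w = Qj (M v) - (b / a) • Qk v := by
    have h1 : Qj ((Ej.symm.toLinearIsometry.comp Qk) v) = Qk v := by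
      show (Ej : EuclideanSpace ℝ (Fin 3) → EuclideanSpace ℝ (Fin 3)) (Ej.symm (Qk v)) = Qk v
      exact Ej.apply_symm_apply _
    rw [hw, map_sub, LinearIsometry.map_smul, h1]
  -- `a • Qj w = [a Aj M v − b Ak v] − a (Aj − Qj)(M v) + b (Ak − Qk) v`
  have hid : a • Qj w = (a • Aj (M v) - b • Ak v) - a • (Aj (M v) - Qj (M v)) + b • (Ak v - Qk v) := by
    rw [hQw, smul_sub, smul_smul, mul_div_cancel₀ _ ha.ne']
    module
  have hnw : a * ‖w‖ ≤ η * ‖v‖ + a * (τ * ‖M v‖) + b * (τ * ‖v‖) := by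
    have : a * ‖w‖ = ‖a • Qj w‖ := by rw [norm_smul, Real.norm_of_nonneg ha.le, LinearIsometry.norm_map]
    have hY : ‖a • (Aj (M v) - Qj (M v))‖ ≤ a * (τ * ‖M v‖) := by
      rw [norm_smul, Real.norm_of_nonneg ha.le]; exact mul_le_mul_of_nonneg_left (hj _) ha.le
    have hZ : ‖b • (Ak v - Qk v)‖ ≤ b * (τ * ‖v‖) := by
      rw [norm_smul, Real.norm_of_nonneg hb.le]; exact mul_le_mul_of_nonneg_left (hk _) hb.le
    rw [this, hid]
    exact norm_add_le_of_le (norm_sub_le_of_le (hM v) hY) hZ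
  -- `‖M v‖ ≤ ‖w‖ + (b/a)‖v‖`
  have hMv : ‖M v‖ ≤ ‖w‖ + b / a * ‖v‖ := by
    have : M v = w + (b / a) • (Ej.symm.toLinearIsometry.comp Qk) v := by rw [hw]; abel
    rw [this]
    refine le_trans (norm_add_le _ _) ?_
    rw [norm_smul, Real.norm_of_nonneg (div_pos hb ha).le, LinearIsometry.norm_map]
  -- combine
  have hv0 := norm_nonneg v
  have hw0 := norm_nonneg w
  have key : a * (1 - τ) * ‖w‖ ≤ (η + 2 * b * τ) * ‖v‖ := by
    have h1 : a * (τ * ‖M v‖) ≤ a * τ * ‖w‖ + b * τ * ‖v‖ := by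
      have := mul_le_mul_of_nonneg_left hMv (mul_nonneg ha.le hτ)
      calc a * (τ * ‖M v‖) = a * τ * ‖M v‖ := by ring
        _ ≤ a * τ * (‖w‖ + b / a * ‖v‖) := this
        _ = a * τ * ‖w‖ + b * τ * ‖v‖ := by field_simp
    nlinarith
  have hfin : ‖w‖ ≤ 1 / 5 * (b / a) * ‖v‖ := by
    rw [show 1 / 5 * (b / a) * ‖v‖ = (b * ‖v‖ / 5) / a by ring, le_div_iff₀ ha]
    have h1τ : 0 < 1 - τ := by linarith
    have : ‖w‖ * a * (1 - τ) ≤ (η + 2 * b * τ) * ‖v‖ := by nlinarith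
    have h2 : (η + 2 * b * τ) * ‖v‖ ≤ b * (1 - τ) / 5 * ‖v‖ := mul_le_mul_of_nonneg_right (by linarith) hv0
    nlinarith
  exact hfin

end Summit.AtomisticToContinuum.Crystallization.Theorems.OverbindingBudgetAffineFarSmoothSplit
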